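import Summits.QuantumFields.YangMills.Theorems.UV3PinnedStepOrganOfTopPartialIterates
import Summits.QuantumFields.YangMills.Theorems.UV3PinnedStepOrganOfPartialIterates
import HarnessLib

/-!
# R3 (cell `ym3-torus`, YM₃ on T³ — a ladder RUNG, NOT d = 4, NOT infinite volume, NOT a mass gap, NOT the Clay problem) —
# **R-19936-S: THE ORGAN ROW (S-ii) `hSii` OF `stub_pinnedStep` FROM THE (α) SOCKET AND THE TOP-LEVEL LETTER hTop ALONE** (the knit of
# `UV3PinnedStepOrganOfTopPartialIterates` §3 with LEAD K-21 `UV3PinnedStepOrganOfPartialIterates` §2)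

Width seat `ym-ust-19936-w3` g19 on crux `stmt-QuantumFields-19936` `UnitScaleTilt.HistoryTailL` (`--supports`, helper; THEOREMS ONLY, 0 `def`,
0 `sorry`).  ★★OWNER WORD 68: the v5-candidate residual row of R-19936 is LETTERED hTop —

  hTop(F) : `∃ c ≥ 0, ∀ K j n, j + n = K → (dU_j^{(K)})∘(iterFrom (avT3 F K) j n)⁻¹ ≤ e^{c}·dU_{j+n}^{(K)}`

(«every segment of the family's block averaging ENDING AT THE UNIT TORUS pushes Haar to at most `e^{c}`·Haar»; one measure inequality per segment; nothing
is asked at the levels `k < K`, whose volume `(2L^{m+K−k})³` grows with `K`).  The parent file derives from hTop the LINEAR mass envelope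
«`m_K(r,·) ≤ (K+1)·e^{A₁}` a.e.» (K-21 §2's binder verbatim); LEAD K-21 §2 `AlphaInputsT3AC.Of.hSii_of_linMassEnvelope` turns that envelope into the
organ row `hSii` (✓p750864 `UV3PinnedStepKnitOfPackage.pinnedTop_of_pinnedLF`'s binder) — the `log(K+1)` floor defect being absorbed by the constrained
heights.  THIS FILE composes the two BY NAME: per family (§1) and under the `∀ L` binder of the faces (§2).  By kernel, with ✓p750864 (`hPinA` ⟸ `hSii`)
and ✓p749772 ∕ its №38-guarded twin ✓`UnitScaleTiltHistoryTailOfPackageMassEnvelope.stub_pinnedStepV3_of_package_of_purePinTop_of_main'`: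
**`stub_pinnedStep` ⟸ v1 socket + `π` + `hMain` + hTop**.

CONTENTS.
* §1 ★★★ `AlphaInputsT3AC.Of.hSii_of_topHaarPushforward` (per family, coupling in the window, depth `m > 0`); ★ `AlphaInputsT3AC.Of.hSii_of_topBlockAvgPushforward`
  (the same with the cruxes' `blockAvg ℰp` family spelled out).
* §2 ★★★ `hSii_forall_of_topHaarPushforward` — the `∀ L` binder `hSii` of ✓`UV3PinnedStepKnitOfPackage.hPinA_of_pinnedLF` ∕ ✓p751371 ∕ ✓p753437's guarded
  faces, VERBATIM, from the sockets and hTop per family (threshold `γ₁ := 1`); `hSii_forall_of_topBlockAvgPushforward`.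

HONEST SCOPE.  Two-line compositions of landed theorems; hTop is DISPLAYED (a hypothesis), NOT proved — OPEN for the tree's `blockAvg ℰp`; nothing of `hlf`,
`stub_pinnedStep`, `stub_unitEnvelope`, `hP′`, `HistoryTailL` (19936), the rung `YM3TorusSU2`, any continuum limit, d = 4, a mass gap or Clay is proved
here.  YM₃ on T³ is rung R3 of the ladder, not the Clay problem.

References: T. Bałaban, Commun. Math. Phys. **102** (1985) 255–275 [Balaban1985UV3] ((41) p. 266, (67)–(71) p. 273, (2) p. 256, (5) p. 257);
T. Bałaban, Commun. Math. Phys. **109** (1987) 249–301 [Balaban1987RG1] ((0.11) p. 253).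
-/

set_option autoImplicit false

noncomputable section

namespace Summit.QuantumFields.YangMills.Theorems.UV3PinnedStepOrganOfTopPartialIteratesKnit

open MeasureTheory
open scoped ENNReal BigOperators
open Literature.MathematicalPhysics.QuantumFieldTheory.Balaban1983to89
open Literature.MathematicalPhysics.QuantumFieldTheory.Balaban1983to89.T4AvgSensitivity (iterFrom)
open Literature.MathematicalPhysics.QuantumFieldTheory.Balaban1983to89.T3ContinuumYM3Torus
open Literature.MathematicalPhysics.QuantumFieldTheory.Balaban1983to89.T3UnitLawDensityEML (ℰp)
open Literature.MathematicalPhysics.QuantumFieldTheory.Balaban1985CMP102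
open Literature.MathematicalPhysics.QuantumFieldTheory.Balaban1985CMP102.Setting
open Summit.QuantumFields.Balaban3D.Carriers
open Summit.QuantumFields.Balaban3D.Proofs.Primitives
open Summit.QuantumFields.Balaban3D.Proofs.TowerAC
open Summit.QuantumFields.Balaban3D.Proofs.StandardAC
open Summit.QuantumFields.Balaban3D.Proofs.InputsAC
open Summit.QuantumFields.Balaban3D.Proofs.MassesAC
open Summit.QuantumFields.YangMills.Theorems.UV3PinnedStepOrganOfTopPartialIterates (iterFrom_avT3_eq_iterFrom_blockAvg)

variable {F : T3Family} {𝔠 : AlphaConsts F.L (suGroupModel 2).N}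

/-! ## §1 Per family -/

open Classical in
/-- ★★★ **THE ORGAN ROW (S-ii) `hSii` (✓p750864 `UV3PinnedStepKnitOfPackage.pinnedTop_of_pinnedLF`'s binder, VERBATIM) FROM THE (α) SOCKET AND THE TOP-LEVEL
LETTER hTop ALONE** (per family `F`, record `𝔠`, socket `h : Of F 𝔠`, coupling `γ` in the window, depth `m > 0`): the parent file's
`linMassEnvelope_of_topHaarPushforward` (hTop ⇒ «`m_K(r,·) ≤ (K+1)·e^{A₁}` a.e.») followed by LEAD K-21's `hSii_of_linMassEnvelope` (the constrained heights absorb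
`K + 1 ≤ (m+2)·β_{K−j}`).  So the S organ of `stub_pinnedStep` displays, beyond the (α) socket and `hMain`, ONLY hTop — a statement about Haar pushed through
the `K`-fold block averaging ONTO THE UNIT TORUS. [cite: Balaban1985UV3, (41) p.266, (67)–(71) p.273, (2) p.256, (5) p.257; Balaban1987RG1, (0.11) p.253] -/
theorem _root_.Summit.QuantumFields.YangMills.Theorems.AlphaInputsT3AC.Of.hSii_of_topHaarPushforward (h : AlphaInputsT3AC.Of F 𝔠)
    (γ : ℝ) (hγ : 0 < γ) (hγ1 : γ ≤ (min 𝔠.gamma0 1) ^ 2) (m : ℕ) (hm : 0 < m)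
    (hTop : ∃ c : ℝ, 0 ≤ c ∧ ∀ (K j n : ℕ), j + n = K →
      (fieldMeasure (F.P K) j (Matrix.specialUnitaryGroup (Fin 2) ℂ)).map (iterFrom (avT3 F K) j n) ≤
        ENNReal.ofReal (Real.exp c) • fieldMeasure (F.P K) (j + n) (Matrix.specialUnitaryGroup (Fin 2) ℂ)) :
    ∃ (CZ c : ℝ) (A : ℕ), 0 < c ∧
      ∀ (K j : ℕ) (hj1 : 1 ≤ j) (hjK : j + 2 ≤ K), j + (K - 1) / m ≤ K → ∀ (a : Plaq (F.P K) j),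
        ∀ᵐ W ∂(fieldMeasure (F.P K) K (Matrix.specialUnitaryGroup (Fin 2) ℂ)),
        ∑ r ∈ Finset.univ.filter (fun r : Hist (F.P K) K =>
            a ∈ r ⟨j, by omega⟩ ∨ ¬ plaqCover a ⊆ Omega 𝔠.lane.carrier.M₁
              (rcolOf (T3Scales F γ hγ (hγ1.trans (sq_min_one_le _ 𝔠.gamma0_pos)) K) 𝔠.lane.carrier) j
              (fun i : Fin j => r (Fin.castLE (by omega) i)) j),
          (inputOfAC 𝔠.lane (h.pkgAt γ hγ hγ1 K).X (h.pkgAt γ hγ hγ1 K).𝔖).W.mass K r W *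
            Real.exp (-((h.pkgAt γ hγ hγ1 K).T.mainT K r W) + (h.pkgAt γ hγ hγ1 K).T.Zterm K r) ≤
        Real.exp CZ * ((F.scheme ℰp γ).β (K - j) ^ A *
          Real.exp (-(c * B10.pFun 𝔠.b₀ 𝔠.p₀ (Real.sqrt (γ * ((F.L : ℝ)⁻¹) ^ (K - j))) ^ 2))) :=
  h.hSii_of_linMassEnvelope γ hγ hγ1 m hm (h.linMassEnvelope_of_topHaarPushforward γ hγ hγ1 hTop)

open Classical in
/-- ★ **… WITH THE CRUXES' `blockAvg ℰp` FAMILY SPELLED OUT**: `hSii` from the (α) socket and «every segment `Ū_{K−1}∘⋯∘Ū_j` of the iterated block averaging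
`blockAvg ℰp` of run `K` ending at the unit torus pushes Haar to `≤ e^{c}`·Haar» (parent file's `linMassEnvelope_of_topBlockAvgPushforward`, then K-21 §2).
[cite: Balaban1985UV3, (41) p.266, (67)–(71) p.273, (2) p.256; Balaban1987RG1, (0.4) + (0.11) p.253] -/
theorem _root_.Summit.QuantumFields.YangMills.Theorems.AlphaInputsT3AC.Of.hSii_of_topBlockAvgPushforward (h : AlphaInputsT3AC.Of F 𝔠)
    (γ : ℝ) (hγ : 0 < γ) (hγ1 : γ ≤ (min 𝔠.gamma0 1) ^ 2) (m : ℕ) (hm : 0 < m)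
    (hTopB : ∃ c : ℝ, 0 ≤ c ∧ ∀ (K j n : ℕ), j + n = K →
      (fieldMeasure (F.P K) j (Matrix.specialUnitaryGroup (Fin 2) ℂ)).map
          (iterFrom (fun i => BlockAveraging.blockAvg (P := F.P K) (G := Matrix.specialUnitaryGroup (Fin 2) ℂ) (j := i) ℰp) j n) ≤
        ENNReal.ofReal (Real.exp c) • fieldMeasure (F.P K) (j + n) (Matrix.specialUnitaryGroup (Fin 2) ℂ)) :
    ∃ (CZ c : ℝ) (A : ℕ), 0 < c ∧
      ∀ (K j : ℕ) (hj1 : 1 ≤ j) (hjK : j + 2 ≤ K), j + (K - 1) / m ≤ K → ∀ (a : Plaq (F.P K) j),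
        ∀ᵐ W ∂(fieldMeasure (F.P K) K (Matrix.specialUnitaryGroup (Fin 2) ℂ)),
        ∑ r ∈ Finset.univ.filter (fun r : Hist (F.P K) K =>
            a ∈ r ⟨j, by omega⟩ ∨ ¬ plaqCover a ⊆ Omega 𝔠.lane.carrier.M₁
              (rcolOf (T3Scales F γ hγ (hγ1.trans (sq_min_one_le _ 𝔠.gamma0_pos)) K) 𝔠.lane.carrier) j
              (fun i : Fin j => r (Fin.castLE (by omega) i)) j),
          (inputOfAC 𝔠.lane (h.pkgAt γ hγ hγ1 K).X (h.pkgAt γ hγ hγ1 K).𝔖).W.mass K r W *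
            Real.exp (-((h.pkgAt γ hγ hγ1 K).T.mainT K r W) + (h.pkgAt γ hγ hγ1 K).T.Zterm K r) ≤
        Real.exp CZ * ((F.scheme ℰp γ).β (K - j) ^ A *
          Real.exp (-(c * B10.pFun 𝔠.b₀ 𝔠.p₀ (Real.sqrt (γ * ((F.L : ℝ)⁻¹) ^ (K - j))) ^ 2))) :=
  h.hSii_of_linMassEnvelope γ hγ hγ1 m hm (h.linMassEnvelope_of_topBlockAvgPushforward γ hγ hγ1 hTopB)

/-! ## §2 The `∀ L` binder of the faces -/

open Classical in
/-- ★★★ **THE `∀ L`-BINDER `hSii` OF THE S-KNIT ∕ THE hP′-FACE ∕ THE GUARDED CRUX FACE FROM THE SOCKETS AND hTop PER FAMILY** (threshold `γ₁ := 1`; every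
coupling in the window): the hypothesis `hSii` of ✓`UV3PinnedStepKnitOfPackage.hPinA_of_pinnedLF`, of ✓p751371 and of ✓p753437's №38-guarded twins, verbatim,
from §1 family by family.  With those and the LEAD socket ✓p748552 the S-half of the 19936 crux face displays `hpkg`, `π`, `hMain` and hTop.
[cite: Balaban1985UV3, (41) p.266, (67)–(71) p.273, (2) p.256, (5) p.257; Balaban1987RG1, (0.11) p.253] -/
theorem hSii_forall_of_topHaarPushforward
    (hTop : ∀ F : T3Family, ∃ c : ℝ, 0 ≤ c ∧ ∀ (K j n : ℕ), j + n = K →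
      (fieldMeasure (F.P K) j (Matrix.specialUnitaryGroup (Fin 2) ℂ)).map (iterFrom (avT3 F K) j n) ≤
        ENNReal.ofReal (Real.exp c) • fieldMeasure (F.P K) (j + n) (Matrix.specialUnitaryGroup (Fin 2) ℂ)) :
    ∀ (L : ℕ) (𝔠 : AlphaConsts L (suGroupModel 2).N)
      (hOf : ∀ (F : T3Family) (hF : F.L = L), AlphaInputsT3AC.Of F (hF ▸ 𝔠)),
        ∀ (m : ℕ), 0 < m →
          ∃ γ₁ : ℝ, 0 < γ₁ ∧ ∀ (F : T3Family) (hF : F.L = L)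
            (γ : ℝ) (hγ : 0 < γ) (hγ1' : γ ≤ (min (hF ▸ 𝔠).gamma0 1) ^ 2), γ ≤ γ₁ →
            ∃ (CZ c : ℝ) (A : ℕ), 0 < c ∧
              ∀ (K j : ℕ) (hj1 : 1 ≤ j) (hjK : j + 2 ≤ K), j + (K - 1) / m ≤ K → ∀ (a : Plaq (F.P K) j),
                ∀ᵐ W ∂(fieldMeasure (F.P K) K (Matrix.specialUnitaryGroup (Fin 2) ℂ)),
                ∑ r ∈ Finset.univ.filter (fun r : Hist (F.P K) K =>
                    a ∈ r ⟨j, by omega⟩ ∨ ¬ plaqCover a ⊆ Omega (hF ▸ 𝔠).lane.carrier.M₁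
                      (rcolOf (T3Scales F γ hγ (hγ1'.trans (sq_min_one_le _ (hF ▸ 𝔠).gamma0_pos)) K) (hF ▸ 𝔠).lane.carrier) j
                      (fun i : Fin j => r (Fin.castLE (by omega) i)) j),
                  (inputOfAC (hF ▸ 𝔠).lane ((hOf F hF).pkgAt γ hγ hγ1' K).X ((hOf F hF).pkgAt γ hγ hγ1' K).𝔖).W.mass K r W *
                    Real.exp (-(((hOf F hF).pkgAt γ hγ hγ1' K).T.mainT K r W) + ((hOf F hF).pkgAt γ hγ hγ1' K).T.Zterm K r) ≤
                Real.exp CZ * ((F.scheme ℰp γ).β (K - j) ^ A *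
                  Real.exp (-(c * B10.pFun (hF ▸ 𝔠).b₀ (hF ▸ 𝔠).p₀ (Real.sqrt (γ * ((F.L : ℝ)⁻¹) ^ (K - j))) ^ 2))) :=
  fun _ _ hOf m hm => ⟨1, one_pos, fun F hF γ hγ hγ1' _ => (hOf F hF).hSii_of_topHaarPushforward γ hγ hγ1' m hm (hTop F)⟩

open Classical in
/-- **… with the `blockAvg ℰp` family spelled out**: the `∀ L`-binder `hSii` from the sockets and the top-level letter for the cruxes' iterated block
averaging, per family. [cite: Balaban1985UV3, (41) p.266, (67)–(71) p.273, (2) p.256; Balaban1987RG1, (0.4) + (0.11) p.253] -/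
theorem hSii_forall_of_topBlockAvgPushforward
    (hTopB : ∀ F : T3Family, ∃ c : ℝ, 0 ≤ c ∧ ∀ (K j n : ℕ), j + n = K →
      (fieldMeasure (F.P K) j (Matrix.specialUnitaryGroup (Fin 2) ℂ)).map
          (iterFrom (fun i => BlockAveraging.blockAvg (P := F.P K) (G := Matrix.specialUnitaryGroup (Fin 2) ℂ) (j := i) ℰp) j n) ≤
        ENNReal.ofReal (Real.exp c) • fieldMeasure (F.P K) (j + n) (Matrix.specialUnitaryGroup (Fin 2) ℂ)) :
    ∀ (L : ℕ) (𝔠 : AlphaConsts L (suGroupModel 2).N)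
      (hOf : ∀ (F : T3Family) (hF : F.L = L), AlphaInputsT3AC.Of F (hF ▸ 𝔠)),
        ∀ (m : ℕ), 0 < m →
          ∃ γ₁ : ℝ, 0 < γ₁ ∧ ∀ (F : T3Family) (hF : F.L = L)
            (γ : ℝ) (hγ : 0 < γ) (hγ1' : γ ≤ (min (hF ▸ 𝔠).gamma0 1) ^ 2), γ ≤ γ₁ →
            ∃ (CZ c : ℝ) (A : ℕ), 0 < c ∧
              ∀ (K j : ℕ) (hj1 : 1 ≤ j) (hjK : j + 2 ≤ K), j + (K - 1) / m ≤ K → ∀ (a : Plaq (F.P K) j),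
                ∀ᵐ W ∂(fieldMeasure (F.P K) K (Matrix.specialUnitaryGroup (Fin 2) ℂ)),
                ∑ r ∈ Finset.univ.filter (fun r : Hist (F.P K) K =>
                    a ∈ r ⟨j, by omega⟩ ∨ ¬ plaqCover a ⊆ Omega (hF ▸ 𝔠).lane.carrier.M₁
                      (rcolOf (T3Scales F γ hγ (hγ1'.trans (sq_min_one_le _ (hF ▸ 𝔠).gamma0_pos)) K) (hF ▸ 𝔠).lane.carrier) j
                      (fun i : Fin j => r (Fin.castLE (by omega) i)) j),
                  (inputOfAC (hF ▸ 𝔠).lane ((hOf F hF).pkgAt γ hγ hγ1' K).X ((hOf F hF).pkgAt γ hγ hγ1' K).𝔖).W.mass K r W *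
                    Real.exp (-(((hOf F hF).pkgAt γ hγ hγ1' K).T.mainT K r W) + ((hOf F hF).pkgAt γ hγ hγ1' K).T.Zterm K r) ≤
                Real.exp CZ * ((F.scheme ℰp γ).β (K - j) ^ A *
                  Real.exp (-(c * B10.pFun (hF ▸ 𝔠).b₀ (hF ▸ 𝔠).p₀ (Real.sqrt (γ * ((F.L : ℝ)⁻¹) ^ (K - j))) ^ 2))) :=
  fun _ _ hOf m hm => ⟨1, one_pos, fun F hF γ hγ hγ1' _ => (hOf F hF).hSii_of_topBlockAvgPushforward γ hγ hγ1' m hm (hTopB F)⟩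

end Summit.QuantumFields.YangMills.Theorems.UV3PinnedStepOrganOfTopPartialIteratesKnit

end
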